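import Summits.NavierStokesRegularity.NavierStokesRegularity.Theses.AngularGalerkinLadder
import Summits.NavierStokesRegularity.NavierStokesRegularity.Theorems.NoOverheating.Negative.LadderLimitExposed
import Summits.NavierStokesRegularity.NavierStokesRegularity.Theorems.QuantisedSymmetryPolyhedralDssProfileExistsStubNoLargeScaleNullSlice
import Mathlib.MeasureTheory.Integral.DominatedConvergence
import Mathlib.MeasureTheory.Function.LocallyIntegrable
import Mathlib.MeasureTheory.Measure.OpenPos

/-!
# KJ-44 — window profiles with uniformly sub-homogeneous tails are excluded
# (Albritton–Barker 2019, Thm 4.1 with `ε = 0`, on the ladder limit: the TAIL corner of K2)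

Refuter lineage, Negative lane of crux K2 `NoOverheating` of route `AngularGalerkinLadder`
(supports, does not decide).  Companion of `L3SliceWindowsExcluded` (KJ-43, the integrability
corner `u(−1) ∈ L³` / finite energy).  A Type-I profile is `O(1/|y|)` at infinity; this file shows
that an admissible window sequence cannot be UNIFORMLY `o(1/|y|)` there:

* `no_windowSequence_nullTail` (§1): constants `1 < cmin`, `0 < δ`, `εₙ → 0`, any rotations, a
  window rung profile with Type-I constant `C₀` at every index, and tails of the slices `uₙ(−1)`
  that are small at infinity UNIFORMLY in `n` — for every `η > 0` a radius `ρ` with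
  `|x| · |uₙ(−1, x)| ≤ η` for `|x| ≥ ρ` and all `n` — are contradictory.  The ladder limit `v`
  (`exists_ladderLimit_typeI`) inherits the tail bound pointwise, so its Navier–Stokes blow-downs
  `λ v(−1)(λ·)` tend to `0` pointwise off the origin under the integrable majorant
  `C₀ |φ(x)|/|x|` (Type I at `t = −1`), hence in `𝒟'` (dominated convergence); the tree theorem
  `stub_noLargeScaleNullSlice` — Albritton–Barker's weak-`L³` backward Liouville theorem, J. Math.
  Fluid Mech. 21 (2019) Thm 4.1 (`ε = 0`), on the Type-I ancient mild class
  (`AlbrittonBarker2019_liouville_weakL3_backward_holds`) — gives `v(−1) = 0` a.e., so `v(−1) ≡ 0`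
  by continuity, against the amplitude floor `δ ≤ ‖v(−1, x₀)‖`.
* §2 reads it on the cruxes: `RungBlowupCofinal` with a `NoOverheating` met by window profiles
  whose slices have uniformly null tails is contradictory.

With KJ-43 this pins the far field of the live K2 region: the slices are `O(C₀/|y|)` (Type I),
not uniformly `o(1/|y|)` (this file), and not uniformly in `L³` or `L²` (KJ-43) — the tail germ
`|y| uₙ(−1, y)` must stay bounded away from zero along the sequence, as for the (discretely)
homogeneous profiles of minus-one degree in print.  WHAT THIS IS NOT: not `¬NoOverheating`; no new
Literature fact, no definition; standard axioms only.
[cite: AlbrittonBarker2019, Theorem 4.1 and the class 𝔹 (arXiv:1811.00502 §4 p. 9)]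
[cite: KochNadirashviliSereginSverak2009, §4 (i)] [cite: BradshawTsai2017CPDE, §1] -/

namespace Summit.NavierStokesRegularity.AngularGalerkinLadderLargeScaleNullTailWindowsExcluded

open Set Filter MeasureTheory Topology Function Metric
open scoped ENNReal NNReal RealInnerProductSpace
open Literature.Analysis Literature.Analysis.FluidPDE
open Summit.NavierStokesRegularity.FluidComputer
open Summit.NavierStokesRegularity.NavierStokesRegularity.Theses.AngularGalerkinLadder
open Summit.NavierStokesRegularity.AngularGalerkinLadderLadderLimit
open Summit.NavierStokesRegularity.NavierStokesRegularity.Theorems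

/-! ### §0 Blow-downs of a Type-I slice with a null tail vanish in `𝒟'` -/

/-- **Null tail ⇒ null blow-downs.**  If a continuous field `g` on `ℝ³` obeys the critical bound
`‖g(y)‖ ≤ C₀/(‖y‖ + 1)` and its tail is `o(1/|y|)` — for every `η > 0` some `ρ` with
`‖y‖ · ‖g(y)‖ ≤ η` for `‖y‖ ≥ ρ` — then the Navier–Stokes blow-downs `λ g(λ·)` tend to `0` in
`𝒟'` as `λ → ∞`: pointwise off the origin `‖λ g(λx)‖ ≤ η/‖x‖` eventually, under the integrable
majorant `C₀ ‖φ(x)‖/‖x‖` (dominated convergence). [folklore] -/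
theorem tendsto_integral_inner_blowdown_of_nullTail
    {g : EuclideanSpace ℝ (Fin 3) → EuclideanSpace ℝ (Fin 3)} (hg : Continuous g) {C₀ : ℝ}
    (hTI : ∀ y, ‖g y‖ ≤ C₀ / (‖y‖ + 1))
    (htail : ∀ η : ℝ, 0 < η → ∃ ρ : ℝ, ∀ y, ρ ≤ ‖y‖ → ‖y‖ * ‖g y‖ ≤ η)
    (φ : EuclideanSpace ℝ (Fin 3) → EuclideanSpace ℝ (Fin 3))
    (hφ : FunctionSpaces.IsTestFunctionOn (⊤ : TopologicalSpace.Opens (EuclideanSpace ℝ (Fin 3))) φ) :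
    Tendsto (fun lam : ℝ => ∫ x, ⟪lam • g (lam • x), φ x⟫) atTop (𝓝 0) := by
  have hC₀ : 0 ≤ C₀ := by
    have h := (norm_nonneg _).trans (hTI 0)
    simpa using h
  have hφc : Continuous φ := hφ.contDiff.continuous
  obtain ⟨Rφ, hRφ⟩ := hφ.hasCompactSupport.isCompact.isBounded.subset_closedBall
    (0 : EuclideanSpace ℝ (Fin 3))
  -- the majorant `C₀ ‖φ x‖ ‖x‖⁻¹`
  set bound : EuclideanSpace ℝ (Fin 3) → ℝ := fun x => C₀ * ‖φ x‖ * ‖x‖ ^ (-(1 : ℝ)) with hbound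
  have hint : Integrable bound volume := by
    have h1 : IntegrableOn (fun x : EuclideanSpace ℝ (Fin 3) => ‖x‖ ^ (-(1 : ℝ)))
        (closedBall 0 Rφ) volume :=
      (NewtonPotentialHolder.integrableOn_ball_norm_rpow_neg (by norm_num : (1 : ℝ) < 3)
        (Rφ + 1)).mono_set
        (closedBall_subset_ball (by linarith))
    have h2 : IntegrableOn bound (closedBall 0 Rφ) volume :=
      h1.continuousOn_mul (continuous_const.mul hφc.norm).continuousOn (isCompact_closedBall _ _)
    refine (integrableOn_iff_integrable_of_support_subset fun x hx => hRφ ?_).1 h2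
    refine subset_tsupport _ (Function.mem_support.2 fun h0 => hx ?_)
    simp [hbound, h0]
  -- domination, for `λ > 0` and `x ≠ 0`
  have hdom : ∀ lam : ℝ, 0 < lam → ∀ x : EuclideanSpace ℝ (Fin 3), x ≠ 0 →
      ‖lam • g (lam • x)‖ ≤ C₀ * ‖x‖ ^ (-(1 : ℝ)) := by
    intro lam hlam x hx
    have hxn : 0 < ‖x‖ := norm_pos_iff.2 hx
    have h := hTI (lam • x)
    rw [norm_smul, Real.norm_of_nonneg hlam.le] at h
    rw [norm_smul, Real.norm_of_nonneg hlam.le, Real.rpow_neg_one]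
    calc lam * ‖g (lam • x)‖ ≤ lam * (C₀ / (lam * ‖x‖ + 1)) := by gcongr
      _ ≤ lam * (C₀ / (lam * ‖x‖)) := by
          gcongr lam * ?_
          exact div_le_div_of_nonneg_left hC₀ (by positivity) (by linarith)
      _ = C₀ * ‖x‖⁻¹ := by field_simp
  have hae0 : ∀ᵐ x ∂(volume : Measure (EuclideanSpace ℝ (Fin 3))), x ≠ 0 := by
    simp [ae_iff]
  have key : Tendsto (fun lam : ℝ => ∫ x, ⟪lam • g (lam • x), φ x⟫) atTop
      (𝓝 (∫ _x : EuclideanSpace ℝ (Fin 3), (0 : ℝ))) := by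
    refine tendsto_integral_filter_of_dominated_convergence bound ?_ ?_ hint ?_
    · refine Eventually.of_forall fun lam => Continuous.aestronglyMeasurable ?_
      have h1 : Continuous fun x : EuclideanSpace ℝ (Fin 3) => lam • g (lam • x) :=
        (hg.comp (continuous_const_smul lam)).const_smul lam
      exact h1.inner hφc
    · filter_upwards [eventually_gt_atTop (0 : ℝ)] with lam hlam
      filter_upwards [hae0] with x hx
      calc ‖⟪lam • g (lam • x), φ x⟫‖ ≤ ‖lam • g (lam • x)‖ * ‖φ x‖ := norm_inner_le_norm _ _
        _ ≤ C₀ * ‖x‖ ^ (-(1 : ℝ)) * ‖φ x‖ := by gcongr; exact hdom lam hlam x hx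
        _ = bound x := by simp only [hbound]; ring
    · filter_upwards [hae0] with x hx
      have hxn : 0 < ‖x‖ := norm_pos_iff.2 hx
      have hsm : Tendsto (fun lam : ℝ => lam • g (lam • x)) atTop (𝓝 0) := by
        rw [NormedAddGroup.tendsto_nhds_zero]
        intro e he
        obtain ⟨ρ, hρ⟩ := htail (e * ‖x‖ / 2) (by positivity)
        filter_upwards [eventually_ge_atTop (ρ / ‖x‖), eventually_gt_atTop (0 : ℝ)] with lam hlamρ
          hlam0
        have hnorm : ‖lam • x‖ = lam * ‖x‖ := by rw [norm_smul, Real.norm_of_nonneg hlam0.le]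
        have hge : ρ ≤ ‖lam • x‖ := by rw [hnorm]; exact (div_le_iff₀ hxn).1 hlamρ
        have h := hρ (lam • x) hge
        rw [hnorm] at h
        rw [norm_smul, Real.norm_of_nonneg hlam0.le]
        have h' : lam * ‖g (lam • x)‖ * ‖x‖ ≤ e / 2 * ‖x‖ := by
          calc lam * ‖g (lam • x)‖ * ‖x‖ = lam * ‖x‖ * ‖g (lam • x)‖ := by ring
            _ ≤ e * ‖x‖ / 2 := h
            _ = e / 2 * ‖x‖ := by ring
        have h'' := le_of_mul_le_mul_right h' hxn
        linarith
      have h := Filter.Tendsto.inner (𝕜 := ℝ) hsm (tendsto_const_nhds (x := φ x))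
      rw [inner_zero_left] at h
      exact h
  simpa using key

/-! ### §1 No admissible window sequence with uniformly null tails -/

/-- **No admissible window sequence has uniformly sub-homogeneous tails.**  Constants `1 < cmin`,
`0 < δ`, `εₙ → 0`, any rotations, a window rung profile with Type-I constant `C₀` at every index,
and slices `uₙ(−1)` that are `o(1/|x|)` at infinity UNIFORMLY in `n` (for every `η > 0` a radius
`ρ` with `‖x‖ · ‖uₙ(−1, x)‖ ≤ η` whenever `‖x‖ ≥ ρ`, for all `n`) are contradictory: the ladder
limit `v` (`exists_ladderLimit_typeI`) has the same tail bound, so its blow-downs `λ v(−1)(λ·)`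
vanish in `𝒟'` (`tendsto_integral_inner_blowdown_of_nullTail`), and Albritton–Barker's weak-`L³`
backward Liouville theorem on the Type-I ancient mild class (`stub_noLargeScaleNullSlice`, from
`AlbrittonBarker2019_liouville_weakL3_backward_holds`) gives `v(−1) = 0` a.e., hence everywhere by
continuity — against `δ ≤ ‖v(−1, x₀)‖`.
[cite: AlbrittonBarker2019, Theorem 4.1 (arXiv:1811.00502 §4 p. 9)] -/
theorem no_windowSequence_nullTail {C₀ cmin cmax δ : ℝ} {L : ℕ → ℕ} {ε c : ℕ → ℝ}
    {R : ℕ → (EuclideanSpace ℝ (Fin 3) ≃ₗᵢ[ℝ] EuclideanSpace ℝ (Fin 3))}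
    {u : ℕ → ℝ → EuclideanSpace ℝ (Fin 3) → EuclideanSpace ℝ (Fin 3)}
    {p : ℕ → ℝ → EuclideanSpace ℝ (Fin 3) → ℝ}
    {d : ℕ → ℝ → EuclideanSpace ℝ (Fin 3) → EuclideanSpace ℝ (Fin 3)}
    (hcmin : 1 < cmin) (hδ : 0 < δ) (hε : Tendsto ε atTop (𝓝 0))
    (hW : ∀ n, AngularLadder.IsWindowProfile (L n) C₀ cmin cmax δ (ε n) (c n) (R n) (u n) (p n)
      (d n))
    (htail : ∀ η : ℝ, 0 < η → ∃ ρ : ℝ, ∀ n x, ρ ≤ ‖x‖ → ‖x‖ * ‖u n (-1) x‖ ≤ η) : False := by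
  obtain ⟨φ, -, -, v, -, -, -, -, hptw, -, hvcont, -, hTAM, hmeas, -, hvTI, ⟨x₀, hx₀⟩, -⟩ :=
    exists_ladderLimit_typeI hcmin hδ hε hW
  have hvm1 : Continuous (v (-1)) := continuous_slice_of_continuousOn_Iio hvcont (by norm_num)
  -- Type I at `t = -1` and the inherited tail bound
  have hTI1 : ∀ y, ‖v (-1) y‖ ≤ C₀ / (‖y‖ + 1) := fun y => by
    have h := hvTI (-1) (by norm_num) y
    rwa [neg_neg, Real.sqrt_one] at h
  have hvtail : ∀ η : ℝ, 0 < η → ∃ ρ : ℝ, ∀ y, ρ ≤ ‖y‖ → ‖y‖ * ‖v (-1) y‖ ≤ η := by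
    intro η hη
    obtain ⟨ρ, hρ⟩ := htail η hη
    exact ⟨ρ, fun y hy => le_of_tendsto' ((hptw (-1) (by norm_num) y).norm.const_mul ‖y‖)
      fun n => hρ (φ n) y hy⟩
  -- Albritton–Barker 2019, Thm 4.1 (`ε = 0`), through the tree stub on the Type-I mild class
  have hae : v (-1) =ᵐ[volume] 0 :=
    PolyhedralDssProfileExists.PolyhedralCell.stub_noLargeScaleNullSlice v C₀
      hTAM.isAncientMildSolution hmeas hvTI (-1) (by norm_num)
      (tendsto_integral_inner_blowdown_of_nullTail hvm1 hTI1 hvtail) (-1) le_rfl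
  have hzero : v (-1) = 0 := (hvm1.ae_eq_iff_eq volume continuous_const).1 hae
  rw [hzero, Pi.zero_apply, norm_zero] at hx₀
  exact absurd hx₀ (not_le.2 hδ)

/-! ### §2 Read on the open cruxes -/

/-- **K1 ∧ (K2 met by window profiles with uniformly null tails) is FALSE.**  `RungBlowupCofinal`
and a `NoOverheating`-type supply of window rung profiles (constant `C₀`, window `[cmin, cmax]`,
`1 < cmin`) whose slices `u(−1)` obey ONE tail modulus `ρ : (0, ∞) → ℝ` —
`‖x‖ · ‖u(−1, x)‖ ≤ η` for `‖x‖ ≥ ρ(η)` — independently of the rung are contradictory.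
[cite: AlbrittonBarker2019, Theorem 4.1] -/
theorem not_cofinal_and_noOverheating_nullTail (C₀ : ℝ) :
    ¬ (RungBlowupCofinal ∧
      ∃ (cmin cmax δ : ℝ) (L₀ : ℕ) (ε : ℕ → ℝ) (ρ : ℝ → ℝ), 1 < cmin ∧ 0 < δ ∧
        Tendsto ε atTop (𝓝 0) ∧
        ∀ L ≥ L₀, AngularLadder.RungIsSingular L →
          ∃ (c : ℝ) (R : EuclideanSpace ℝ (Fin 3) ≃ₗᵢ[ℝ] EuclideanSpace ℝ (Fin 3))
            (u : ℝ → EuclideanSpace ℝ (Fin 3) → EuclideanSpace ℝ (Fin 3))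
            (p : ℝ → EuclideanSpace ℝ (Fin 3) → ℝ)
            (d : ℝ → EuclideanSpace ℝ (Fin 3) → EuclideanSpace ℝ (Fin 3)),
            AngularLadder.IsWindowProfile L C₀ cmin cmax δ (ε L) c R u p d ∧
              ∀ η : ℝ, 0 < η → ∀ x, ρ η ≤ ‖x‖ → ‖x‖ * ‖u (-1) x‖ ≤ η) := by
  rintro ⟨h₁, cmin, cmax, δ, L₀, ε, ρ, hcmin, hδ, hε, hwin⟩
  choose L hLge hLsing using fun n : ℕ => h₁ (max L₀ n)
  choose c R u p d hW htail using fun n : ℕ =>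
    hwin (L n) (le_trans (le_max_left _ _) (hLge n)) (hLsing n)
  have hε' : Tendsto (fun n : ℕ => ε (L n)) atTop (𝓝 0) :=
    hε.comp (tendsto_atTop_mono (fun n => le_trans (le_max_right _ _) (hLge n)) tendsto_id)
  exact no_windowSequence_nullTail hcmin hδ hε' hW
    fun η hη => ⟨ρ η, fun n x hx => htail n η hη x hx⟩

/-- `RungBlowupCofinal` fails as soon as `NoOverheating` is met with ONE tail modulus for the
slices (contrapositive packaging of `not_cofinal_and_noOverheating_nullTail`).
[cite: AlbrittonBarker2019, Theorem 4.1] -/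
theorem rungBlowupCofinal_false_of_noOverheating_nullTail (C₀ : ℝ)
    (h : ∃ (cmin cmax δ : ℝ) (L₀ : ℕ) (ε : ℕ → ℝ) (ρ : ℝ → ℝ), 1 < cmin ∧ 0 < δ ∧
        Tendsto ε atTop (𝓝 0) ∧
        ∀ L ≥ L₀, AngularLadder.RungIsSingular L →
          ∃ (c : ℝ) (R : EuclideanSpace ℝ (Fin 3) ≃ₗᵢ[ℝ] EuclideanSpace ℝ (Fin 3))
            (u : ℝ → EuclideanSpace ℝ (Fin 3) → EuclideanSpace ℝ (Fin 3))
            (p : ℝ → EuclideanSpace ℝ (Fin 3) → ℝ)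
            (d : ℝ → EuclideanSpace ℝ (Fin 3) → EuclideanSpace ℝ (Fin 3)),
            AngularLadder.IsWindowProfile L C₀ cmin cmax δ (ε L) c R u p d ∧
              ∀ η : ℝ, 0 < η → ∀ x, ρ η ≤ ‖x‖ → ‖x‖ * ‖u (-1) x‖ ≤ η) :
    ¬ RungBlowupCofinal := fun h₁ => not_cofinal_and_noOverheating_nullTail C₀ ⟨h₁, h⟩

end Summit.NavierStokesRegularity.AngularGalerkinLadderLargeScaleNullTailWindowsExcluded
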